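import Literature.Probability.RandomPlanarGeometry.ArcHullDomains
import Literature.Topology.PlaneTopology.JordanCurveProofs
import Literature.Topology.PlaneTopology.HalfPlaneArc
import HarnessLib

/-!
# The interior of a Jordan arc hull is connected and accumulates at its real points

Plane topology of the hulls `J ∈ 𝒬` bounded in `ℍ` by a Jordan arc with distinct real endpoints
(`Literature.Probability.RandomPlanarGeometry.IsArcHull`, the topological form of the smooth
hulls of Lawler–Schramm–Werner, *Conformal restriction: the chordal case* (2003), §2 p. 8),
complementing `ArcHullDomains` (`IsArcHull.sides`): with the arc `P` from `x₀` to `x₁` and the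
two complementary components `U` (bounded) and `V` (unbounded) of the symmetric Jordan curve
`P ∪ P̄` (Jordan curve theorem, PROVED in the tree: `JordanCurveTheorem_holds`),

* `isPathConnected_inter_upperHalfPlaneSet_of_conj` — the upper half `U ∩ ℍ` of an open
  connected set `U` symmetric under complex conjugation is path connected (fold a path in `U`
  onto the closed upper half-plane by `w ↦ re w + i|im w|` — the tree's
  `Literature.Topology.PlaneTopology.foldUp` of `HalfPlaneArc`, where the same trick serves
  `ℍ` minus an arc — and push it up by a small `iε`);
* `IsArcHull.exists_sides_interior_eq` / `IsArcHull.isPreconnected_interior` — **the interior of an arc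
  hull is `U ∩ ℍ`, in particular connected**;
* `IsArcHull.exists_ofReal_mem_closure_interior` — some real point of `J` (any point of
  `(x₀, x₁)`) is a limit of interior points of `J`.

These feed the Loewner-chain fact "`K_T ∩ A ⊂ ∂A`" of [LSW] Lemma 6.3 for arc hulls
(`LoewnerHullHittingArc`). Nothing here is specific to Loewner chains.
-/

noncomputable section

open Set Filter Metric Complex Function
open _root_.Topology
open UpperHalfPlane (upperHalfPlaneSet isOpen_upperHalfPlaneSet)
open Literature.Topology.PlaneTopology (foldUp continuous_foldUp foldUp_of_nonneg foldUp_of_neg foldUp_im)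
open scoped unitInterval ComplexConjugate

namespace Literature.Probability.RandomPlanarGeometry

/-! ### Folding onto the closed upper half-plane -/

/-- **The upper half of a symmetric open connected set is path connected.** If `U ⊆ ℂ` is open,
connected and symmetric under complex conjugation, then `U ∩ ℍ` is path connected (when
nonempty): join two points by a path in `U`, fold it onto the closed upper half-plane (the fold
stays in `U` by symmetry), and push the folded path up by `iε`, `ε` smaller than the distance
from the (compact) folded path to `Uᶜ`. [folklore] -/
theorem isPathConnected_inter_upperHalfPlaneSet_of_conj {U : Set ℂ} (hUo : IsOpen U)
    (hUc : IsConnected U) (hsymm : conj '' U ⊆ U) (hne : (U ∩ upperHalfPlaneSet).Nonempty) :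
    IsPathConnected (U ∩ upperHalfPlaneSet) := by
  obtain ⟨p, hp⟩ := hne
  refine ⟨p, hp, fun {q} hq ↦ ?_⟩
  have hpath : IsPathConnected U := (hUo.isConnected_iff_isPathConnected).1 hUc
  obtain ⟨γ, hγ⟩ := hpath.joinedIn p hp.1 q hq.1
  -- the folded path stays in `U`
  have hfoldU : ∀ t, foldUp (γ t) ∈ U := fun t ↦ by
    rcases le_or_gt 0 (γ t).im with h | h
    · rw [foldUp_of_nonneg h]; exact hγ t
    · rw [foldUp_of_neg h]; exact hsymm ⟨γ t, hγ t, rfl⟩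
  set S : Set ℂ := range fun t : I ↦ foldUp (γ t) with hS
  have hSc : IsCompact S := isCompact_range (continuous_foldUp.comp γ.continuous)
  have hSU : S ⊆ U := by rintro _ ⟨t, rfl⟩; exact hfoldU t
  obtain ⟨δ, hδ, hthick⟩ := hSc.exists_cthickening_subset_open hUo hSU
  have hnear : ∀ t (v : ℂ), dist v (foldUp (γ t)) ≤ δ → v ∈ U := fun t v hv ↦
    hthick (Metric.mem_cthickening_of_dist_le v (foldUp (γ t)) δ S ⟨t, rfl⟩ hv)
  have hp0 : foldUp (γ 0) = p := by rw [γ.source, foldUp_of_nonneg (le_of_lt hp.2)]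
  have hq1 : foldUp (γ 1) = q := by rw [γ.target, foldUp_of_nonneg (le_of_lt hq.2)]
  set e : ℂ := (δ : ℂ) * Complex.I with he
  have he_norm : ‖e‖ = δ := by
    rw [he, norm_mul, Complex.norm_real, Complex.norm_I, mul_one, Real.norm_eq_abs, abs_of_pos hδ]
  have he_im : e.im = δ := by simp [he]
  -- vertical segments from a point of `U ∩ ℍ` on the folded path
  have hseg : ∀ (t : I) (w : ℂ), foldUp (γ t) = w → 0 < w.im →
      JoinedIn (U ∩ upperHalfPlaneSet) w (w + e) := by
    intro t w hw hwim
    refine ⟨{ toFun := fun s ↦ w + ((s : ℝ) : ℂ) * e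
              continuous_toFun := by fun_prop
              source' := by simp
              target' := by simp }, fun s ↦ ⟨?_, ?_⟩⟩
    · refine hnear t _ ?_
      show dist (w + ((s : ℝ) : ℂ) * e) (foldUp (γ t)) ≤ δ
      rw [hw, dist_eq_norm, add_sub_cancel_left, norm_mul, Complex.norm_real, he_norm,
        Real.norm_eq_abs, abs_of_nonneg s.2.1]
      nlinarith [s.2.2]
    · show 0 < (w + ((s : ℝ) : ℂ) * e).im
      rw [add_im, he]
      simp only [mul_im, ofReal_re, ofReal_im, I_re, I_im, mul_zero, mul_one, zero_mul, add_zero]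
      nlinarith [s.2.1]
  -- the pushed-up folded path
  have hmid : JoinedIn (U ∩ upperHalfPlaneSet) (p + e) (q + e) := by
    refine ⟨{ toFun := fun t ↦ foldUp (γ t) + e
              continuous_toFun := (continuous_foldUp.comp γ.continuous).add continuous_const
              source' := by rw [hp0]
              target' := by rw [hq1] }, fun t ↦ ⟨?_, ?_⟩⟩
    · refine hnear t _ ?_
      show dist (foldUp (γ t) + e) (foldUp (γ t)) ≤ δ
      rw [dist_eq_norm, add_sub_cancel_left, he_norm]
    · show 0 < (foldUp (γ t) + e).im
      rw [add_im, foldUp_im, he_im]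
      positivity
  exact ((hseg 0 p hp0 hp.2).trans hmid).trans (hseg 1 q hq1 hq.2).symm

/-! ### The two sides of the symmetric Jordan curve of an arc hull -/

section Sides

variable {J : Set ℂ}

/-- **The complementary components of a symmetric Jordan curve are symmetric**: for the curve
`Λ = P ∪ P̄` of `JordanCurveTheorem.symmetric`, with bounded component `U` and unbounded
component `V`, `conj(U) ⊆ U` and `conj(V) ⊆ V` (each of `conj(U)`, `conj(V)` is connected
and misses `Λ`, and boundedness decides the side). [folklore] -/
theorem conj_image_subset_of_sides {Λ U V : Set ℂ} (hΛ : conj '' Λ = Λ) (hUo : IsOpen U)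
    (hVo : IsOpen V) (hUc : IsConnected U) (hVc : IsConnected V) (hUV : Disjoint U V)
    (hunion : U ∪ V = Λᶜ) (hUb : Bornology.IsBounded U) (hVb : ¬ Bornology.IsBounded V) :
    conj '' U ⊆ U ∧ conj '' V ⊆ V := by
  have hsubU : ∀ {S : Set ℂ}, IsPreconnected S → S ⊆ Λᶜ → S ⊆ U ∨ S ⊆ V := fun hS hSΛ ↦
    hS.subset_or_subset hUo hVo hUV (hunion.symm ▸ hSΛ)
  have hΛc_symm : ∀ {S : Set ℂ}, S ⊆ Λᶜ → conj '' S ⊆ Λᶜ := by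
    rintro S hS _ ⟨w, hw, rfl⟩ hmem
    have : conj (conj w) ∈ conj '' Λ := ⟨_, hmem, rfl⟩
    rw [conj_conj, hΛ] at this
    exact hS hw this
  have hconjconj : ∀ S : Set ℂ, conj '' (conj '' S) = S := fun S ↦ by
    rw [← image_comp]; ext w; simp
  have hVsymm : conj '' V ⊆ V := by
    rcases hsubU (hVc.isPreconnected.image _ continuous_conj.continuousOn)
      (hΛc_symm (hunion ▸ subset_union_right)) with h | h
    · exfalso
      refine hVb ?_
      rw [← hconjconj V]
      exact isometry_conj.lipschitz.isBounded_image (hUb.subset h)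
    · exact h
  refine ⟨?_, hVsymm⟩
  rcases hsubU (hUc.isPreconnected.image _ continuous_conj.continuousOn)
    (hΛc_symm (hunion ▸ subset_union_left)) with h | h
  · exact h
  · exfalso
    obtain ⟨u, hu⟩ := hUc.nonempty
    have h1 : u ∈ V := by
      have : conj (conj u) ∈ conj '' V := ⟨_, h ⟨u, hu, rfl⟩, rfl⟩
      rw [conj_conj] at this
      exact hVsymm this
    exact Set.disjoint_left.1 hUV hu h1

/-- The interior of a bounded hull lies in the open upper half-plane. [folklore] -/
theorem IsBoundedHull.interior_subset {A : Set ℂ} (hA : IsBoundedHull A) :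
    interior A ⊆ upperHalfPlaneSet := by
  have h1 : interior A ⊆ interior {z : ℂ | 0 ≤ z.im} := by
    refine interior_mono (hA.subset_closure.trans ?_)
    rw [show upperHalfPlaneSet = {z : ℂ | 0 < z.im} from rfl, Complex.closure_setOf_lt_im]
  rw [Complex.interior_setOf_le_im] at h1
  exact h1

/-- **The interior of an arc hull is the upper half of the inside of its symmetric Jordan
curve**, and the sides data: there are `x₀ < x₁`, the arc `P`, and open sets `U` (bounded,
connected, symmetric) with `interior J = U ∩ ℍ`, such that the points of `(x₀, x₁)` lie in `U`
and in `J`. [folklore] -/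
theorem IsArcHull.exists_sides_interior_eq (hJ : IsArcHull J) :
    ∃ (x₀ x₁ : ℝ) (U : Set ℂ), x₀ < x₁ ∧ IsOpen U ∧ IsConnected U ∧ conj '' U ⊆ U ∧
      interior J = U ∩ upperHalfPlaneSet ∧
      (∀ x : ℝ, x₀ < x → x < x₁ → (x : ℂ) ∈ U ∧ (x : ℂ) ∈ J) := by
  obtain ⟨x₀, x₁, P, hlt, hPi, him, hreal, hPJ, hfr, hncl, hIcc⟩ :=
    hJ.sides Literature.Topology.PlaneTopology.JordanCurveTheorem_holds
  obtain ⟨U, V, hUo, hVo, hUc, hVc, hUV, hunion, hfU, -, hUb, hVb⟩ :=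
    Literature.Topology.PlaneTopology.JordanCurveTheorem_holds.symmetric P hPi him hreal
  set Λ : Set ℂ := range P ∪ conj '' range P with hΛ
  have hΛsymm : conj '' Λ = Λ := by
    rw [hΛ, image_union, ← image_comp, union_comm]
    congr 1
    ext w; simp
  obtain ⟨hUsymm, -⟩ := conj_image_subset_of_sides hΛsymm hUo hVo hUc hVc hUV hunion hUb hVb
  have hJc : IsClosed J := hJ.1.isClosed
  -- points of `Λ` in `ℍ` are on the arc, at interior parameters, hence on `∂J`
  have hΛfr : ∀ w ∈ Λ, 0 < w.im → w ∈ frontier J := by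
    rintro w (⟨s, rfl⟩ | ⟨_, ⟨s, rfl⟩, rfl⟩) hpos
    · have hs0 : 0 < (s : ℝ) := by
        by_contra h
        have : s = 0 := Subtype.ext (le_antisymm (not_lt.1 h) s.2.1)
        rw [this, P.source, ofReal_im] at hpos
        exact lt_irrefl _ hpos
      have hs1 : (s : ℝ) < 1 := by
        by_contra h
        have : s = 1 := Subtype.ext (le_antisymm s.2.2 (not_lt.1 h))
        rw [this, P.target, ofReal_im] at hpos
        exact lt_irrefl _ hpos
      have : P s ∈ upperHalfPlaneSet ∩ frontier J := by rw [hfr]; exact ⟨s, ⟨hs0, hs1⟩, rfl⟩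
      exact this.2
    · exfalso
      rw [conj_im] at hpos
      linarith [him s]
  -- (i) `ℍ ∖ J ⊆ V`
  have hHJV : upperHalfPlaneSet \ J ⊆ V := by
    have hconn : IsConnected (upperHalfPlaneSet \ J) := hJ.1.2.2.isPathConnected.isConnected
    obtain ⟨R, hR⟩ := hJ.1.1.subset_closedBall 0
    have hunb : ¬ Bornology.IsBounded (upperHalfPlaneSet \ J) := fun hb ↦ by
      obtain ⟨R', hR'⟩ := hb.subset_closedBall 0
      set z : ℂ := ((|R| + |R'| + 1 : ℝ) : ℂ) * Complex.I with hz
      have hzim : z.im = |R| + |R'| + 1 := by simp [hz]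
      have hzn : ‖z‖ = |R| + |R'| + 1 := by
        rw [hz, norm_mul, norm_real, norm_I, mul_one, Real.norm_eq_abs, abs_of_pos (by positivity)]
      have hzmem : z ∈ upperHalfPlaneSet \ J := by
        refine ⟨by show 0 < z.im; rw [hzim]; positivity, fun hzJ ↦ ?_⟩
        have h1 := hR hzJ
        rw [mem_closedBall, dist_zero_right, hzn] at h1
        linarith [le_abs_self R, abs_nonneg R']
      have h2 := hR' hzmem
      rw [mem_closedBall, dist_zero_right, hzn] at h2
      linarith [le_abs_self R', abs_nonneg R]
    have hdisj : upperHalfPlaneSet \ J ⊆ Λᶜ := by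
      intro z hz hzΛ
      exact hz.2 (hJc.frontier_subset (hΛfr z hzΛ hz.1))
    rcases hconn.isPreconnected.subset_or_subset hUo hVo hUV (hunion.symm ▸ hdisj) with h | h
    · exact absurd (hUb.subset h) hunb
    · exact h
  -- (ii) `U ∩ ℍ ⊆ interior J`
  have hUint : U ∩ upperHalfPlaneSet ⊆ interior J := by
    rintro u ⟨hu, hpos⟩
    have huΛ : u ∉ Λ := fun h ↦ (show u ∈ Λᶜ by rw [← hunion]; exact Or.inl hu) h
    have huJ : u ∈ J := by
      by_contra h
      exact Set.disjoint_left.1 hUV hu (hHJV ⟨hpos, h⟩)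
    have hufr : u ∉ frontier J := fun h ↦ by
      have : u ∈ upperHalfPlaneSet ∩ frontier J := ⟨hpos, h⟩
      rw [hfr] at this
      obtain ⟨s, -, hs⟩ := this
      exact huΛ (Or.inl ⟨s, hs⟩)
    rw [← self_sdiff_frontier]
    exact ⟨huJ, hufr⟩
  -- (iii) `interior J ⊆ U`: the upper half of `V` is connected and contains `ℍ ∖ J ≠ ∅`
  have hintH : interior J ⊆ upperHalfPlaneSet := hJ.1.interior_subset
  have hintU : interior J ⊆ U := by
    intro w hw
    have hwH : w ∈ upperHalfPlaneSet := hintH hw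
    have hwΛ : w ∈ Λᶜ := fun h ↦ (hΛfr w h hwH).2 hw
    rcases (show w ∈ U ∪ V by rw [hunion]; exact hwΛ) with h | hwV
    · exact h
    exfalso
    -- `V ∩ ℍ` is covered by the disjoint open sets `ℍ ∖ J` and `interior J`
    obtain ⟨-, hVsymm⟩ := conj_image_subset_of_sides hΛsymm hUo hVo hUc hVc hUV hunion hUb hVb
    have hVH : IsPreconnected (V ∩ upperHalfPlaneSet) :=
      (isPathConnected_inter_upperHalfPlaneSet_of_conj hVo hVc hVsymm
        ⟨w, hwV, hwH⟩).isConnected.isPreconnected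
    have hcover : V ∩ upperHalfPlaneSet ⊆ (upperHalfPlaneSet \ J) ∪ interior J := by
      rintro v ⟨hvV, hvH⟩
      by_cases hvJ : v ∈ J
      · right
        rw [← self_sdiff_frontier]
        refine ⟨hvJ, fun hvfr ↦ ?_⟩
        have : v ∈ upperHalfPlaneSet ∩ frontier J := ⟨hvH, hvfr⟩
        rw [hfr] at this
        obtain ⟨s, -, hs⟩ := this
        have hvΛ : v ∈ Λ := Or.inl ⟨s, hs⟩
        exact (show v ∈ Λᶜ by rw [← hunion]; exact Or.inr hvV) hvΛ
      · exact Or.inl ⟨hvH, hvJ⟩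
    have hdisj : Disjoint (upperHalfPlaneSet \ J) (interior J) :=
      Set.disjoint_left.2 fun v hv hvi ↦ hv.2 (interior_subset hvi)
    have hHJo : IsOpen (upperHalfPlaneSet \ J) := isOpen_upperHalfPlaneSet.sdiff hJc
    rcases hVH.subset_or_subset hHJo isOpen_interior hdisj hcover with h | h
    · exact (h ⟨hwV, hwH⟩).2 (interior_subset hw)
    · -- then `ℍ ∖ J ⊆ interior J ⊆ J`, so `ℍ ⊆ J`, which is bounded
      have hsub : upperHalfPlaneSet \ J ⊆ J := fun v hv ↦ interior_subset (h ⟨hHJV hv, hv.1⟩)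
      obtain ⟨R, hR⟩ := hJ.1.1.subset_closedBall 0
      set z : ℂ := ((|R| + 1 : ℝ) : ℂ) * Complex.I with hz
      have hzim : 0 < z.im := by simp [hz]; positivity
      have hzn : ‖z‖ = |R| + 1 := by
        rw [hz, norm_mul, norm_real, norm_I, mul_one, Real.norm_eq_abs, abs_of_pos (by positivity)]
      have hzJ : z ∈ J := by
        by_cases h' : z ∈ J
        · exact h'
        · exact hsub ⟨hzim, h'⟩
      have := hR hzJ
      rw [mem_closedBall, dist_zero_right, hzn] at this
      linarith [le_abs_self R]
  refine ⟨x₀, x₁, U, hlt, hUo, hUc, hUsymm, ?_, fun x hx0 hx1 ↦ ⟨?_, hIcc x hx0.le hx1.le⟩⟩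
  · exact Subset.antisymm (fun w hw ↦ ⟨hintU hw, hintH hw⟩) hUint
  · -- `x ∉ Λ` (real points of `Λ` are `x₀, x₁`) and `x ∉ V` (else `x ∈ closure (ℍ ∖ J)`? no:
    -- use the folded structure: `x ∈ U ∪ V`; if `x ∈ V`, points `x + iε ∈ V ∩ ℍ` for small `ε`
    -- would be interior points of `J` in `V`, impossible by (iii))
    have hxΛ : (x : ℂ) ∈ Λᶜ := by
      rintro (⟨s, hs⟩ | ⟨_, ⟨s, rfl⟩, hs⟩)
      · rcases hreal s (by rw [hs, ofReal_im]) with h | h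
        · have : (x : ℝ) = x₀ := by exact_mod_cast hs.symm.trans h
          linarith
        · have : (x : ℝ) = x₁ := by exact_mod_cast hs.symm.trans h
          linarith
      · have hs0 : (P s).im = 0 := by
          have := congrArg Complex.im hs
          rw [conj_im, ofReal_im] at this
          linarith
        rcases hreal s hs0 with h | h
        · have h' : conj (P s) = x₀ := by rw [h, conj_ofReal]
          have : (x : ℝ) = x₀ := by exact_mod_cast hs.symm.trans h'
          linarith
        · have h' : conj (P s) = x₁ := by rw [h, conj_ofReal]
          have : (x : ℝ) = x₁ := by exact_mod_cast hs.symm.trans h'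
          linarith
    rcases (show (x : ℂ) ∈ U ∪ V by rw [hunion]; exact hxΛ) with h | hxV
    · exact h
    exfalso
    -- a small ball around `x` inside `V`; its upper half consists of points of `J` (as
    -- `x ∉ closure (ℍ ∖ J)`), i.e. of interior points of `J`, which lie in `U`
    have hxncl := hncl x hx0 hx1
    have hnhd : ∃ ρ > 0, ball (x : ℂ) ρ ⊆ V ∧ Disjoint (ball (x : ℂ) ρ) (upperHalfPlaneSet \ J) := by
      obtain ⟨ρ₁, hρ₁, hb₁⟩ := Metric.isOpen_iff.1 hVo x hxV
      have : (x : ℂ) ∉ closure (upperHalfPlaneSet \ J) := hxncl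
      rw [Metric.mem_closure_iff, not_forall] at this
      obtain ⟨ρ₂, hρ₂⟩ := this
      rw [Classical.not_imp] at hρ₂
      obtain ⟨hρ₂pos, hρ₂far⟩ := hρ₂
      refine ⟨min ρ₁ ρ₂, lt_min hρ₁ hρ₂pos, (ball_subset_ball (min_le_left _ _)).trans hb₁,
        Set.disjoint_left.2 fun w hw hw' ↦ hρ₂far ⟨w, hw', ?_⟩⟩
      rw [mem_ball, dist_comm] at hw
      exact hw.trans_le (min_le_right _ _)
    obtain ⟨ρ, hρ, hbV, hbJ⟩ := hnhd
    set w : ℂ := (x : ℂ) + ((ρ / 2 : ℝ) : ℂ) * Complex.I with hw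
    have hwim : w.im = ρ / 2 := by simp [hw]
    have hwball : w ∈ ball (x : ℂ) ρ := by
      rw [mem_ball, dist_eq_norm, hw, add_sub_cancel_left, norm_mul, norm_real, norm_I, mul_one,
        Real.norm_eq_abs, abs_of_pos (by positivity)]
      linarith
    have hwH : w ∈ upperHalfPlaneSet := by show 0 < w.im; rw [hwim]; positivity
    have hwJ : w ∈ J := by
      by_contra h
      exact Set.disjoint_left.1 hbJ hwball ⟨hwH, h⟩
    have hwint : w ∈ interior J := by
      rw [mem_interior_iff_mem_nhds]
      have h1 : ball (x : ℂ) ρ ∩ upperHalfPlaneSet ∈ 𝓝 w :=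
        (isOpen_ball.inter isOpen_upperHalfPlaneSet).mem_nhds ⟨hwball, hwH⟩
      refine mem_of_superset h1 fun v hv ↦ ?_
      by_contra h
      exact Set.disjoint_left.1 hbJ hv.1 ⟨hv.2, h⟩
    exact Set.disjoint_left.1 hUV (hintU hwint) (hbV hwball)

/-- **The interior of a Jordan arc hull is connected.** [folklore] -/
theorem IsArcHull.isPreconnected_interior (hJ : IsArcHull J) : IsPreconnected (interior J) := by
  obtain ⟨x₀, x₁, U, -, hUo, hUc, hUsymm, hint, -⟩ := hJ.exists_sides_interior_eq
  rw [hint]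
  rcases (U ∩ upperHalfPlaneSet).eq_empty_or_nonempty with h | hne
  · rw [h]; exact isPreconnected_empty
  · exact (isPathConnected_inter_upperHalfPlaneSet_of_conj hUo hUc hUsymm hne).isConnected.isPreconnected

/-- **Real points of an arc hull in the closure of its interior**: there is a real point of `J`
(any point strictly between the endpoints of the arc) which is a limit of interior points of
`J` — the points `x + iε ∈ U ∩ ℍ = interior J`. [folklore] -/
theorem IsArcHull.exists_ofReal_mem_closure_interior (hJ : IsArcHull J) :
    ∃ x : ℝ, (x : ℂ) ∈ J ∧ (x : ℂ) ∈ closure (interior J) := by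
  obtain ⟨x₀, x₁, U, hlt, hUo, -, -, hint, hmid⟩ := hJ.exists_sides_interior_eq
  set x : ℝ := (x₀ + x₁) / 2 with hx
  obtain ⟨hxU, hxJ⟩ := hmid x (by rw [hx]; linarith) (by rw [hx]; linarith)
  refine ⟨x, hxJ, ?_⟩
  have hseq : Tendsto (fun n : ℕ ↦ (x : ℂ) + ((1 : ℝ) / (n + 1) : ℝ) * Complex.I) atTop
      (𝓝 (x : ℂ)) := by
    have h1 : Tendsto (fun n : ℕ ↦ ((1 : ℝ) / (n + 1) : ℝ)) atTop (𝓝 0) :=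
      tendsto_one_div_add_atTop_nhds_zero_nat
    have h2 : Tendsto (fun n : ℕ ↦ (((1 : ℝ) / (n + 1) : ℝ) : ℂ) * Complex.I) atTop
        (𝓝 (((0 : ℝ) : ℂ) * Complex.I)) :=
      ((continuous_ofReal.tendsto 0).comp h1).mul tendsto_const_nhds
    simpa using tendsto_const_nhds.add h2
  refine mem_closure_of_tendsto hseq ?_
  have hevU := hseq.eventually (hUo.mem_nhds hxU)
  filter_upwards [hevU] with n hn
  rw [hint]
  refine ⟨hn, ?_⟩
  show 0 < ((x : ℂ) + ((1 : ℝ) / (n + 1) : ℝ) * Complex.I).im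
  rw [add_im, ofReal_im, mul_I_im, ofReal_re, zero_add]
  positivity

end Sides

end Literature.Probability.RandomPlanarGeometry
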